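import Mathlib
import Summits.Ventures.PercRepro2.CoinChainTowerMarker
import Summits.Ventures.PercRepro2.CoinTowerClose

/-!
# The marker at a MIDDLE vertex of an OR-tower (blind cell PercRepro2, night-2 g18; §58.9)

A pendant OR-tower over a log-supermodular core `U` split at a vertex `v`: the LOWER tower `low`
(sure coins, arbitrary entries), `v` (sure coins, arbitrary entries in the lower tower core), the
UPPER tower `up` and the free-arc vertex `a` (any coins, entries `m₂` or outside the lower core);
markers `(v, m₂)`.  After the reductions over `a`, `up` and `v`, the lower tower is reduced by
the sure-coin closure (`OrTower.sum_close`, no invariance of the marker needed); `clSet` is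
monotone and a join-homomorphism, so the closed laws stay log-supermodular and decreasing, and
the covering is automatic.  **`darc_of_towerMarkerMid`**, `_swap`, the out-tree corollary;
`darc_of_towerMarkerV₁` (§57.13) is the case `low = []`.
-/

namespace Summit.Ventures.PercRepro2.Coin

open Classical

section TowerMarkerMid

variable {V : Type*} {E : Type*} [Fintype V] [DecidableEq V] [Fintype E] [DecidableEq E]
  {R : Type*} [Field R] [LinearOrder R] [IsStrictOrderedRing R]
  {arcs : E → Finset (V × V)} {s : V} {U : Finset V} {ent entv : Finset V} {c cv : V → E}
  {a v w : V} {low up : List (Finset V × (V → E) × V)}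

/-- **THEOREM (the first marker at a MIDDLE vertex of an OR-tower).** `low` an OR-tower over `U`
(SURE coins), `v` an OR-vertex of its core (SURE coins), `up` an OR-tower over `insert v _` and `a`
an OR-vertex of its core (ANY coins, every entry `m₂` or outside the lower core), the cluster law of
`U` log-supermodular, `m₂ ∈ U`, `t, w ∉ insert a (…)`, `t, w ≠ s` ⟹ `DARC pr arcs s {t} v m₂ a w`. -/
theorem darc_of_towerMarkerMid (pr : E → R) (hp : IsProbVec pr) (hS : SameEnds arcs)
    (hL : OrTower arcs s U low) (hsureL : ∀ x ∈ low, ∀ r ∈ x.1, pr (x.2.1 r) = 1)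
    (hv : OrTailK arcs s (towerCore U low) entv cv v) (hsure : ∀ r ∈ entv, pr (cv r) = 1)
    (hT : OrTower arcs s (insert v (towerCore U low)) up)
    (h : OrTailK arcs s (towerCore (insert v (towerCore U low)) up) ent c a)
    {m₂ : V} (hm₂ : m₂ ∈ U) (hcovL : ∀ x ∈ up, ∀ r ∈ x.1, r = m₂ ∨ r ∉ towerCore U low)
    (hcov : ∀ r ∈ ent, r = m₂ ∨ r ∉ towerCore U low)
    (hν : ∀ W W', W ⊆ U → W' ⊆ U →
      prob pr (coreLevel arcs s U W) * prob pr (coreLevel arcs s U W') ≤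
        prob pr (coreLevel arcs s U (W ∩ W')) * prob pr (coreLevel arcs s U (W ∪ W')))
    {t : V} (htC : t ∉ insert a (towerCore (insert v (towerCore U low)) up)) (hts : t ≠ s)
    (hws : w ≠ s) (hwC : w ∉ insert a (towerCore (insert v (towerCore U low)) up)) :
    DARC pr arcs s {t} v m₂ a w := by
  have hC := h.closedInCoreU
  have hvU₁ : v ∉ towerCore U low := hv.a_notin
  have hUU₁ : U ⊆ towerCore U low := subset_towerCore U low
  have hU₁C : insert v (towerCore U low) ⊆ towerCore (insert v (towerCore U low)) up :=
    subset_towerCore _ up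
  have haC' : a ∉ towerCore (insert v (towerCore U low)) up := h.a_notin
  have hva : v ≠ a := fun e => haC' (e ▸ hU₁C (Finset.mem_insert_self v _))
  have hm₂U₁ : m₂ ∈ towerCore U low := hUU₁ hm₂
  have hm₂a : m₂ ≠ a := fun e => haC' (e ▸ hU₁C (Finset.mem_insert_of_mem hm₂U₁))
  have hm₂v : m₂ ≠ v := fun e => hvU₁ (e ▸ hm₂U₁)
  have hvert := hT.vertex_notin
  have hvv : ∀ x ∈ up, v ≠ x.2.2 := fun x hx e => hvert x hx (e ▸ Finset.mem_insert_self v _)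
  have hm₂v' : ∀ x ∈ up, m₂ ≠ x.2.2 :=
    fun x hx e => hvert x hx (e ▸ Finset.mem_insert_of_mem hm₂U₁)
  have hvertL := hL.vertex_notin
  have hm₂L : ∀ x ∈ low, m₂ ≠ x.2.2 := fun x hx e => hvertL x hx (e ▸ hm₂)
  have hvC : v ∈ insert a (towerCore (insert v (towerCore U low)) up) :=
    Finset.mem_insert_of_mem (hU₁C (Finset.mem_insert_self v _))
  have hm₂C : m₂ ∈ insert a (towerCore (insert v (towerCore U low)) up) :=
    Finset.mem_insert_of_mem (hU₁C (Finset.mem_insert_of_mem hm₂U₁))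
  have haC : a ∈ insert a (towerCore (insert v (towerCore U low)) up) := Finset.mem_insert_self _ _
  unfold DARC
  rw [hC.phiC_gate_eq pr hS htC hts hvC hm₂C haC hws hwC]
  -- the marker functions and their invariances under `insert a` and under the upper vertices
  have hm1 : ∀ W : Finset V, (fun _ : Finset V => (1 : R)) (insert a W) = (fun _ => (1 : R)) W :=
    fun _ => rfl
  have hm1L : ∀ x ∈ up, ∀ W : Finset V, (fun _ : Finset V => (1 : R)) (insert x.2.2 W) =
    (fun _ => (1 : R)) W := fun _ _ _ => rfl
  have hm1' : ∀ W : Finset V, (fun _ : Finset V => (1 : R)) (insert v W) = (fun _ => (1 : R)) W :=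
    fun _ => rfl
  have hxa : ∀ W : Finset V, (fun W : Finset V => if v ∈ W then (1 : R) else 0) (insert a W) =
      (fun W : Finset V => if v ∈ W then (1 : R) else 0) W := by
    intro W; simp only [Finset.mem_insert, hva, false_or]
  have hxL : ∀ x ∈ up, ∀ W : Finset V,
      (fun W : Finset V => if v ∈ W then (1 : R) else 0) (insert x.2.2 W) =
      (fun W : Finset V => if v ∈ W then (1 : R) else 0) W := by
    intro x hx W; simp only [Finset.mem_insert, hvv x hx, false_or]
  have hya : ∀ W : Finset V, (fun W : Finset V => if m₂ ∈ W then (1 : R) else 0) (insert a W) =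
      (fun W : Finset V => if m₂ ∈ W then (1 : R) else 0) W := by
    intro W; simp only [Finset.mem_insert, hm₂a, false_or]
  have hyL : ∀ x ∈ up, ∀ W : Finset V,
      (fun W : Finset V => if m₂ ∈ W then (1 : R) else 0) (insert x.2.2 W) =
      (fun W : Finset V => if m₂ ∈ W then (1 : R) else 0) W := by
    intro x hx W; simp only [Finset.mem_insert, hm₂v' x hx, false_or]
  have hya' : ∀ W : Finset V, (fun W : Finset V => if m₂ ∈ W then (1 : R) else 0) (insert v W) =
      (fun W : Finset V => if m₂ ∈ W then (1 : R) else 0) W := by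
    intro W; simp only [Finset.mem_insert, hm₂v, false_or]
  have hxya : ∀ W : Finset V,
      (fun W : Finset V => (if v ∈ W then (1 : R) else 0) * (if m₂ ∈ W then (1 : R) else 0))
        (insert a W) =
      (fun W : Finset V => (if v ∈ W then (1 : R) else 0) * (if m₂ ∈ W then (1 : R) else 0)) W := by
    intro W; simp only [Finset.mem_insert, hva, hm₂a, false_or]
  have hxyL : ∀ x ∈ up, ∀ W : Finset V,
      (fun W : Finset V => (if v ∈ W then (1 : R) else 0) * (if m₂ ∈ W then (1 : R) else 0))
        (insert x.2.2 W) =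
      (fun W : Finset V => (if v ∈ W then (1 : R) else 0) * (if m₂ ∈ W then (1 : R) else 0)) W := by
    intro x hx W; simp only [Finset.mem_insert, hvv x hx, hm₂v' x hx, false_or]
  -- the marker `1[v ∈ W]` vanishes off `v` and is `1` on `insert v W`
  have hg0 : ∀ W : Finset V, v ∉ W → (fun W : Finset V => if v ∈ W then (1 : R) else 0) W = 0 :=
    by intro W hW; simp only [hW, if_false]
  have hg1 : ∀ W : Finset V, v ∉ W →
      (fun W : Finset V => if v ∈ W then (1 : R) else 0) (insert v W) = (fun _ => (1 : R)) W := by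
    intro W _; simp only [Finset.mem_insert_self, if_true]
  have hq0 : ∀ W : Finset V, v ∉ W →
      (fun W : Finset V => (if v ∈ W then (1 : R) else 0) * (if m₂ ∈ W then (1 : R) else 0)) W
        = 0 := by intro W hW; simp only [hW, if_false, zero_mul]
  have hq1 : ∀ W : Finset V, v ∉ W →
      (fun W : Finset V => (if v ∈ W then (1 : R) else 0) * (if m₂ ∈ W then (1 : R) else 0))
          (insert v W) =
        (fun W : Finset V => if m₂ ∈ W then (1 : R) else 0) W := by
    intro W _
    simp only [Finset.mem_insert_self, if_true, one_mul, Finset.mem_insert, hm₂v, false_or]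
  -- the level reduction over `a`
  have eΛ := h.sum_R_eq pr t (fun _ => (1 : R)) hm1
  have eFa := h.sum_R_eq pr t (fun W => if v ∈ W then (1 : R) else 0) hxa
  have eFb := h.sum_R_eq pr t (fun W => if m₂ ∈ W then (1 : R) else 0) hya
  have eM := h.sum_G_eq (w := w) pr t (fun _ => (1 : R)) hm1
  have eX := h.sum_G_eq (w := w) pr t (fun W => if v ∈ W then (1 : R) else 0) hxa
  have eY := h.sum_G_eq (w := w) pr t (fun W => if m₂ ∈ W then (1 : R) else 0) hya
  have eXY := h.sum_G_eq (w := w) pr t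
    (fun W => (if v ∈ W then (1 : R) else 0) * (if m₂ ∈ W then (1 : R) else 0)) hxya
  simp only [mul_one] at eΛ eM; rw [eΛ, eFa, eFb, eM, eX, eY, eXY]
  set A : Finset V → R := fun X =>
    prob pr (coreAvoidEvent arcs s t (insert a (towerCore (insert v (towerCore U low)) up)) X)
    with hAdef
  obtain ⟨hA0, hAmono, hAlsm⟩ :=
    OrTailU.head_props (U := towerCore (insert v (towerCore U low)) up) (a := a) pr hp hS t
  have hp0 := hp.nonneg; have hp1 := hp.le_one
  set FR : Finset V → R := rValK A pr ent c a with hFR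
  set FG : Finset V → R := gValK A pr ent c a w with hFG
  -- the tower reduction (the vertices above `v`)
  have tΛ := hT.sum_tower pr FR (fun _ => (1 : R)) hm1L
  have tFa := hT.sum_tower pr FR (fun W => if v ∈ W then (1 : R) else 0) hxL
  have tFb := hT.sum_tower pr FR (fun W => if m₂ ∈ W then (1 : R) else 0) hyL
  have tM := hT.sum_tower pr FG (fun _ => (1 : R)) hm1L
  have tX := hT.sum_tower pr FG (fun W => if v ∈ W then (1 : R) else 0) hxL
  have tY := hT.sum_tower pr FG (fun W => if m₂ ∈ W then (1 : R) else 0) hyL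
  have tXY := hT.sum_tower pr FG
    (fun W => (if v ∈ W then (1 : R) else 0) * (if m₂ ∈ W then (1 : R) else 0)) hxyL
  simp only [mul_one] at tΛ tM; rw [tΛ, tFa, tFb, tM, tX, tY, tXY]
  set TR : Finset V → R := towerVal pr up FR with hTR
  set TG : Finset V → R := towerVal pr up FG with hTG
  -- the level reduction over `v` (core `towerCore U low`)
  have fΛ := hv.sum_gen pr TR (fun _ => (1 : R)) hm1'
  have fFa := hv.sum_gen_tail pr TR (fun W => if v ∈ W then (1 : R) else 0) (fun _ => (1 : R))
    hg0 hg1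
  have fFb := hv.sum_gen pr TR (fun W => if m₂ ∈ W then (1 : R) else 0) hya'
  have fM := hv.sum_gen pr TG (fun _ => (1 : R)) hm1'
  have fX := hv.sum_gen_tail pr TG (fun W => if v ∈ W then (1 : R) else 0) (fun _ => (1 : R))
    hg0 hg1
  have fY := hv.sum_gen pr TG (fun W => if m₂ ∈ W then (1 : R) else 0) hya'
  have fXY := hv.sum_gen_tail pr TG
    (fun W => (if v ∈ W then (1 : R) else 0) * (if m₂ ∈ W then (1 : R) else 0))
    (fun W => if m₂ ∈ W then (1 : R) else 0) hq0 hq1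
  simp only [mul_one] at fΛ fFa fM fX
  rw [fΛ, fFa, fFb, fM, fX, fY, fXY]
  -- the closures at `v`, as explicit summands over the lower tower core
  set CR : Finset V → R := closeB entv v TR with hCR
  set CG : Finset V → R := closeB entv v TG with hCG
  have cΛ : (∑ W ∈ (towerCore U low).powerset, prob pr (coreLevel arcs s (towerCore U low) W) *
      (tailWtK pr entv cv W * TR W + (1 - tailWtK pr entv cv W) * TR (W ∪ {v}))) =
      ∑ W ∈ (towerCore U low).powerset, prob pr (coreLevel arcs s (towerCore U low) W) * CR W :=
    Finset.sum_congr rfl fun W _ => by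
      simp only [hCR]; rw [closeB_of_sure pr cv v TR hsure W]
  have cFa : (∑ W ∈ (towerCore U low).powerset, prob pr (coreLevel arcs s (towerCore U low) W) *
      ((1 - tailWtK pr entv cv W) * TR (W ∪ {v}))) =
      ∑ W ∈ (towerCore U low).powerset, prob pr (coreLevel arcs s (towerCore U low) W) *
        (CR W * (if ∃ r ∈ entv, r ∈ W then (1 : R) else 0)) :=
    Finset.sum_congr rfl fun W _ => by
      simp only [hCR]; rw [closeB_of_sure_tail pr cv v TR hsure W]
  have cFb : (∑ W ∈ (towerCore U low).powerset, prob pr (coreLevel arcs s (towerCore U low) W) *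
      (tailWtK pr entv cv W * TR W + (1 - tailWtK pr entv cv W) * TR (W ∪ {v})) *
        (if m₂ ∈ W then (1 : R) else 0)) =
      ∑ W ∈ (towerCore U low).powerset, prob pr (coreLevel arcs s (towerCore U low) W) *
        (CR W * (if m₂ ∈ W then (1 : R) else 0)) :=
    Finset.sum_congr rfl fun W _ => by
      simp only [hCR]; rw [closeB_of_sure pr cv v TR hsure W, mul_assoc]
  have cM : (∑ W ∈ (towerCore U low).powerset, prob pr (coreLevel arcs s (towerCore U low) W) *
      (tailWtK pr entv cv W * TG W + (1 - tailWtK pr entv cv W) * TG (W ∪ {v}))) =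
      ∑ W ∈ (towerCore U low).powerset, prob pr (coreLevel arcs s (towerCore U low) W) * CG W :=
    Finset.sum_congr rfl fun W _ => by
      simp only [hCG]; rw [closeB_of_sure pr cv v TG hsure W]
  have cX : (∑ W ∈ (towerCore U low).powerset, prob pr (coreLevel arcs s (towerCore U low) W) *
      ((1 - tailWtK pr entv cv W) * TG (W ∪ {v}))) =
      ∑ W ∈ (towerCore U low).powerset, prob pr (coreLevel arcs s (towerCore U low) W) *
        (CG W * (if ∃ r ∈ entv, r ∈ W then (1 : R) else 0)) :=
    Finset.sum_congr rfl fun W _ => by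
      simp only [hCG]; rw [closeB_of_sure_tail pr cv v TG hsure W]
  have cY : (∑ W ∈ (towerCore U low).powerset, prob pr (coreLevel arcs s (towerCore U low) W) *
      (tailWtK pr entv cv W * TG W + (1 - tailWtK pr entv cv W) * TG (W ∪ {v})) *
        (if m₂ ∈ W then (1 : R) else 0)) =
      ∑ W ∈ (towerCore U low).powerset, prob pr (coreLevel arcs s (towerCore U low) W) *
        (CG W * (if m₂ ∈ W then (1 : R) else 0)) :=
    Finset.sum_congr rfl fun W _ => by
      simp only [hCG]; rw [closeB_of_sure pr cv v TG hsure W, mul_assoc]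
  have cXY : (∑ W ∈ (towerCore U low).powerset, prob pr (coreLevel arcs s (towerCore U low) W) *
      ((1 - tailWtK pr entv cv W) * TG (W ∪ {v})) * (if m₂ ∈ W then (1 : R) else 0)) =
      ∑ W ∈ (towerCore U low).powerset, prob pr (coreLevel arcs s (towerCore U low) W) *
        (CG W * ((if ∃ r ∈ entv, r ∈ W then (1 : R) else 0) * (if m₂ ∈ W then (1 : R) else 0))) :=
    Finset.sum_congr rfl fun W _ => by
      simp only [hCG]; rw [closeB_of_sure_tail pr cv v TG hsure W]; ring
  rw [cΛ, cFa, cFb, cM, cX, cY, cXY]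
  -- the lower tower reduction: every summand at the closed level
  have dΛ := hL.sum_close pr hsureL (fun W => CR W)
  have dFa := hL.sum_close pr hsureL (fun W => CR W * (if ∃ r ∈ entv, r ∈ W then (1 : R) else 0))
  have dFb := hL.sum_close pr hsureL (fun W => CR W * (if m₂ ∈ W then (1 : R) else 0))
  have dM := hL.sum_close pr hsureL (fun W => CG W)
  have dX := hL.sum_close pr hsureL (fun W => CG W * (if ∃ r ∈ entv, r ∈ W then (1 : R) else 0))
  have dY := hL.sum_close pr hsureL (fun W => CG W * (if m₂ ∈ W then (1 : R) else 0))
  have dXY := hL.sum_close pr hsureL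
    (fun W => CG W * ((if ∃ r ∈ entv, r ∈ W then (1 : R) else 0) * (if m₂ ∈ W then (1 : R) else 0)))
  beta_reduce at dΛ dFa dFb dM dX dY dXY
  rw [dΛ, dFa, dFb, dM, dX, dY, dXY]
  -- the laws and the markers on the levels of `U`
  set G : Finset V → R := fun W => prob pr (coreLevel arcs s U W) * CR (clSet low W) with hGdef
  set G' : Finset V → R := fun W => prob pr (coreLevel arcs s U W) * CG (clSet low W) with hG'def
  set x : Finset V → R := fun W => if ∃ r ∈ entv, r ∈ clSet low W then (1 : R) else 0 with hxdef
  set y : Finset V → R := fun W => if m₂ ∈ clSet low W then (1 : R) else 0 with hydef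
  have rFa : (∑ W ∈ U.powerset, prob pr (coreLevel arcs s U W) *
      (CR (clSet low W) * (if ∃ r ∈ entv, r ∈ clSet low W then (1 : R) else 0))) =
      ∑ W ∈ U.powerset, G W * x W := Finset.sum_congr rfl fun W _ => by simp only [hGdef, hxdef]; ring
  have rFb : (∑ W ∈ U.powerset, prob pr (coreLevel arcs s U W) *
      (CR (clSet low W) * (if m₂ ∈ clSet low W then (1 : R) else 0))) =
      ∑ W ∈ U.powerset, G W * y W := Finset.sum_congr rfl fun W _ => by simp only [hGdef, hydef]; ring
  have rX : (∑ W ∈ U.powerset, prob pr (coreLevel arcs s U W) *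
      (CG (clSet low W) * (if ∃ r ∈ entv, r ∈ clSet low W then (1 : R) else 0))) =
      ∑ W ∈ U.powerset, G' W * x W :=
    Finset.sum_congr rfl fun W _ => by simp only [hG'def, hxdef]; ring
  have rY : (∑ W ∈ U.powerset, prob pr (coreLevel arcs s U W) *
      (CG (clSet low W) * (if m₂ ∈ clSet low W then (1 : R) else 0))) =
      ∑ W ∈ U.powerset, G' W * y W :=
    Finset.sum_congr rfl fun W _ => by simp only [hG'def, hydef]; ring
  have rXY : (∑ W ∈ U.powerset, prob pr (coreLevel arcs s U W) *
      (CG (clSet low W) * ((if ∃ r ∈ entv, r ∈ clSet low W then (1 : R) else 0) *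
        (if m₂ ∈ clSet low W then (1 : R) else 0)))) =
      ∑ W ∈ U.powerset, G' W * (x W * y W) :=
    Finset.sum_congr rfl fun W _ => by simp only [hG'def, hxdef, hydef]; ring
  rw [rFa, rFb, rX, rY, rXY]
  -- the hypotheses of the monotone four-atom sandwich
  have hν0 : ∀ W, 0 ≤ prob pr (coreLevel arcs s U W) := fun W => prob_nonneg hp _
  have hFR0 : ∀ W, 0 ≤ FR W := fun W => rValK_nonneg hp0 hp1 hA0 ent c a W
  have hFG0 : ∀ W, 0 ≤ FG W := fun W => gValK_nonneg hp0 hp1 hA0 ent c a w W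
  have hFRlsm : ∀ s t : Finset V, FR s * FR t ≤ FR (s ∩ t) * FR (s ∪ t) := fun s t =>
    rValK_mul_le_all A pr ent c a hp0 hp1 hA0 hAlsm hAmono s t
  have hFGlsm : ∀ s t : Finset V, FG s * FG t ≤ FG (s ∩ t) * FG (s ∪ t) := fun s t =>
    gValK_mul_le_all A pr ent c a w hp0 hp1 hA0 hAlsm hAmono s t
  have hFRmono : ∀ s t : Finset V, s ⊆ t → FR t ≤ FR s := fun _ _ hst =>
    rValK_antitone hp0 hp1 hAmono ent c a hst
  have hFGmono : ∀ s t : Finset V, s ⊆ t → FG t ≤ FG s := fun _ _ hst =>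
    gValK_antitone hp0 hp1 hAmono ent c a w hst
  have hFGle : ∀ W, FG W ≤ FR W := fun W => gValK_le_rValK hp0 hp1 hAmono ent c a w W
  obtain ⟨hTR0, hTRlsm, hTRmono⟩ := towerVal_props pr hp0 hp1 up FR hFR0 hFRlsm hFRmono
  obtain ⟨hTG0, hTGlsm, hTGmono⟩ := towerVal_props pr hp0 hp1 up FG hFG0 hFGlsm hFGmono
  have hTGle : ∀ W, TG W ≤ TR W := fun W => towerVal_head_le pr hp0 hp1 up hFGle W
  have hCR0 : ∀ W, 0 ≤ CR W := fun W => closeB_nonneg entv v TR hTR0 W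
  have hCG0 : ∀ W, 0 ≤ CG W := fun W => closeB_nonneg entv v TG hTG0 W
  have hCRmono : ∀ s t : Finset V, s ⊆ t → CR t ≤ CR s := closeB_mono entv v TR hTRmono
  have hCGmono : ∀ s t : Finset V, s ⊆ t → CG t ≤ CG s := closeB_mono entv v TG hTGmono
  have hCGle : ∀ W, CG W ≤ CR W := fun W => closeB_le_closeB entv v hTGle W
  have hcl : ∀ W ⊆ U, clSet low W ⊆ towerCore U low := fun W hW => clSet_subset_towerCore low U W hW
  have hvcl : ∀ W ⊆ U, v ∉ clSet low W := fun W hW hmem => hvU₁ (hcl W hW hmem)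
  have hG0 : ∀ W, 0 ≤ G W := fun W => mul_nonneg (hν0 W) (hCR0 _)
  have hG'0 : ∀ W, 0 ≤ G' W := fun W => mul_nonneg (hν0 W) (hCG0 _)
  have hx01 : ∀ W, x W = 0 ∨ x W = 1 := by intro W; simp only [hxdef]; split_ifs <;> simp
  have hy01 : ∀ W, y W = 0 ∨ y W = 1 := by intro W; simp only [hydef]; split_ifs <;> simp
  have hxm : ∀ s t : Finset V, s ⊆ t → x s ≤ x t := by
    intro s t hst
    have hcst := clSet_mono low hst
    simp only [hxdef]
    by_cases hs : ∃ r ∈ entv, r ∈ clSet low s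
    · obtain ⟨r, hr, hrs⟩ := hs
      rw [if_pos ⟨r, hr, hrs⟩, if_pos ⟨r, hr, hcst hrs⟩]
    · rw [if_neg hs]; split_ifs <;> norm_num
  have hym : ∀ s t : Finset V, s ⊆ t → y s ≤ y t := by
    intro s t hst
    have hcst := clSet_mono low hst
    simp only [hydef]
    by_cases hs : m₂ ∈ clSet low s
    · rw [if_pos hs, if_pos (hcst hs)]
    · rw [if_neg hs]; split_ifs <;> norm_num
  -- log-supermodularity of the closed laws: `clSet` is monotone and a join-homomorphism
  have key : ∀ (F : Finset V → R), (∀ W, 0 ≤ F W) →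
      (∀ s t : Finset V, v ∉ s → v ∉ t → F s * F t ≤ F (s ∩ t) * F (s ∪ t)) →
      (∀ s t : Finset V, s ⊆ t → F t ≤ F s) →
      ∀ S ⊆ U, ∀ T ⊆ U, F (clSet low S) * F (clSet low T) ≤
        F (clSet low (S ∩ T)) * F (clSet low (S ∪ T)) := by
    intro F hF0 hFlsm hFmono S hS T hT
    have h1 := hFlsm (clSet low S) (clSet low T) (hvcl S hS) (hvcl T hT)
    have h2 : clSet low (S ∩ T) ⊆ clSet low S ∩ clSet low T :=
      Finset.subset_inter (clSet_mono low Finset.inter_subset_left)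
        (clSet_mono low Finset.inter_subset_right)
    have h3 := hFmono _ _ h2
    rw [clSet_union]
    calc F (clSet low S) * F (clSet low T)
        ≤ F (clSet low S ∩ clSet low T) * F (clSet low S ∪ clSet low T) := h1
      _ ≤ F (clSet low (S ∩ T)) * F (clSet low S ∪ clSet low T) :=
          mul_le_mul_of_nonneg_right h3 (hF0 _)
  have wLL : ∀ S ⊆ U, ∀ T ⊆ U, G S * G T ≤ G (S ∩ T) * G (S ∪ T) := by
    intro S hS T hT
    have hk := key CR hCR0 (fun s t hs ht => closeB_lsm entv v TR hTR0 hTRlsm hTRmono hs ht)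
      hCRmono S hS T hT
    simp only [hGdef]
    calc prob pr (coreLevel arcs s U S) * CR (clSet low S) *
          (prob pr (coreLevel arcs s U T) * CR (clSet low T))
        = (prob pr (coreLevel arcs s U S) * prob pr (coreLevel arcs s U T)) *
            (CR (clSet low S) * CR (clSet low T)) := by ring
      _ ≤ (prob pr (coreLevel arcs s U (S ∩ T)) * prob pr (coreLevel arcs s U (S ∪ T))) *
            (CR (clSet low (S ∩ T)) * CR (clSet low (S ∪ T))) :=
          mul_le_mul (hν S T hS hT) hk (mul_nonneg (hCR0 _) (hCR0 _))
            (mul_nonneg (hν0 _) (hν0 _))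
      _ = _ := by ring
  have wMM : ∀ S ⊆ U, ∀ T ⊆ U, G' S * G' T ≤ G' (S ∩ T) * G' (S ∪ T) := by
    intro S hS T hT
    have hk := key CG hCG0 (fun s t hs ht => closeB_lsm entv v TG hTG0 hTGlsm hTGmono hs ht)
      hCGmono S hS T hT
    simp only [hG'def]
    calc prob pr (coreLevel arcs s U S) * CG (clSet low S) *
          (prob pr (coreLevel arcs s U T) * CG (clSet low T))
        = (prob pr (coreLevel arcs s U S) * prob pr (coreLevel arcs s U T)) *
            (CG (clSet low S) * CG (clSet low T)) := by ring
      _ ≤ (prob pr (coreLevel arcs s U (S ∩ T)) * prob pr (coreLevel arcs s U (S ∪ T))) *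
            (CG (clSet low (S ∩ T)) * CG (clSet low (S ∪ T))) :=
          mul_le_mul (hν S T hS hT) hk (mul_nonneg (hCG0 _) (hCG0 _))
            (mul_nonneg (hν0 _) (hν0 _))
      _ = _ := by ring
  have hle : ∀ W ∈ U.powerset, G' W ≤ G W := fun W _ =>
    mul_le_mul_of_nonneg_left (hCGle _) (hν0 W)
  have h00 : ∀ W ∈ U.powerset, x W = 0 → y W = 0 → G' W = G W := by
    intro W hW hx hy
    have hWU : W ⊆ U := Finset.mem_powerset.1 hW
    have hnov : ¬ ∃ r ∈ entv, r ∈ clSet low W := by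
      intro hex
      simp only [hxdef, if_pos hex] at hx
      exact one_ne_zero hx
    have hm₂W : m₂ ∉ clSet low W := by
      intro hmem
      simp only [hydef, if_pos hmem] at hy
      exact one_ne_zero hy
    have hnoL : ∀ z ∈ up, ∀ r ∈ z.1, r ∉ clSet low W := by
      intro z hz r hr hrW
      rcases hcovL z hz r hr with rfl | hrU
      · exact hm₂W hrW
      · exact hrU (hcl W hWU hrW)
    have hno : ∀ r ∈ ent, r ∉ clSet low W := by
      intro r hr hrW
      rcases hcov r hr with rfl | hrU
      · exact hm₂W hrW
      · exact hrU (hcl W hWU hrW)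
    simp only [hGdef, hG'def, hCR, hCG]
    rw [closeB_of_no_entry entv v TR hnov, closeB_of_no_entry entv v TG hnov]
    simp only [hTR, hTG]
    rw [towerVal_of_no_entry pr up FR hnoL, towerVal_of_no_entry pr up FG hnoL]
    simp only [hFR, hFG]
    rw [gValK_eq_rValK_of_no_entry A pr c a w hno]
  exact fourAtom_functional_nonneg_mono U G G' x y hG0 hG'0 hx01 hy01 hxm hym wLL wMM hle h00

/-- **The mirror: markers `(m₂, v)`.** -/
theorem darc_of_towerMarkerMid_swap (pr : E → R) (hp : IsProbVec pr) (hS : SameEnds arcs)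
    (hL : OrTower arcs s U low) (hsureL : ∀ x ∈ low, ∀ r ∈ x.1, pr (x.2.1 r) = 1)
    (hv : OrTailK arcs s (towerCore U low) entv cv v) (hsure : ∀ r ∈ entv, pr (cv r) = 1)
    (hT : OrTower arcs s (insert v (towerCore U low)) up)
    (h : OrTailK arcs s (towerCore (insert v (towerCore U low)) up) ent c a)
    {m₂ : V} (hm₂ : m₂ ∈ U) (hcovL : ∀ x ∈ up, ∀ r ∈ x.1, r = m₂ ∨ r ∉ towerCore U low)
    (hcov : ∀ r ∈ ent, r = m₂ ∨ r ∉ towerCore U low)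
    (hν : ∀ W W', W ⊆ U → W' ⊆ U →
      prob pr (coreLevel arcs s U W) * prob pr (coreLevel arcs s U W') ≤
        prob pr (coreLevel arcs s U (W ∩ W')) * prob pr (coreLevel arcs s U (W ∪ W')))
    {t : V} (htC : t ∉ insert a (towerCore (insert v (towerCore U low)) up)) (hts : t ≠ s)
    (hws : w ≠ s) (hwC : w ∉ insert a (towerCore (insert v (towerCore U low)) up)) :
    DARC pr arcs s {t} m₂ v a w :=
  (darc_swap pr arcs s {t} v m₂ a w).1
    (darc_of_towerMarkerMid pr hp hS hL hsureL hv hsure hT h hm₂ hcovL hcov hν htC hts hws hwC)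

/-- **COROLLARY (out-tree core).** -/
theorem darc_of_towerTreeMarkerMid (pr : E → R) (hp : IsProbVec pr) (hS : SameEnds arcs)
    (hL : OrTower arcs s U low) (hsureL : ∀ x ∈ low, ∀ r ∈ x.1, pr (x.2.1 r) = 1)
    (hv : OrTailK arcs s (towerCore U low) entv cv v) (hsure : ∀ r ∈ entv, pr (cv r) = 1)
    (hT : OrTower arcs s (insert v (towerCore U low)) up)
    (h : OrTailK arcs s (towerCore (insert v (towerCore U low)) up) ent c a)
    {cT : V → E} {par : V → V} {rk : V → ℕ} (hTr : TreeCore arcs s U cT par rk)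
    {m₂ : V} (hm₂ : m₂ ∈ U) (hcovL : ∀ x ∈ up, ∀ r ∈ x.1, r = m₂ ∨ r ∉ towerCore U low)
    (hcov : ∀ r ∈ ent, r = m₂ ∨ r ∉ towerCore U low)
    {t : V} (htC : t ∉ insert a (towerCore (insert v (towerCore U low)) up)) (hts : t ≠ s)
    (hws : w ≠ s) (hwC : w ∉ insert a (towerCore (insert v (towerCore U low)) up)) :
    DARC pr arcs s {t} v m₂ a w :=
  darc_of_towerMarkerMid pr hp hS hL hsureL hv hsure hT h hm₂ hcovL hcov (hTr.coreLevel_lsm pr hp)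
    htC hts hws hwC

end TowerMarkerMid

end Summit.Ventures.PercRepro2.Coin
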